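import Mathlib
import Literature.NumberTheory.Transcendental.KZCalculusProofs
import Literature.NumberTheory.Transcendental.KZLogCalculusProofs
import Literature.NumberTheory.Transcendental.KZSemiCanonicalReductionProofs
import Summits.KontsevichZagierPeriods.KontsevichZagierPeriods.Theorems.HyperbolicBlochOffTetraSectorKernelStubSimilarityMove
import Summits.KontsevichZagierPeriods.KontsevichZagierPeriods.Theorems.HyperbolicBlochOffTetraSectorKernelRungZeroIntervals

/-!
# Stub `stub_angleKernel` — crux `OffTetraSectorKernel`, line `odd-hyperbolic-ladder` (skeleton v4, lead c3)

Rung 1 of the hyperbolic scissors ladder (areas of `ℚ̄`-geodesic polygons of the hyperbolic plane, upper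
half-plane model `p : Fin 2 → ℝ`, `x = p 0`, `t = p 1`, density `t⁻²`): **every `ℤ`-linear relation among areas
of V-pieces `V α β a c = {α < x < β, 0 < t, c < (x − a)² + t²}` is a Kontsevich–Zagier relation.**

* §1 ANGLE ALGEBRA of the standard doubly-ideal triangles `Std γ = V γ 1 0 1` (area `arccos γ`): from the
  three-triangle relation (`stub_threeTriangles`, a hypothesis here) the classes `U θ = [Std (cos θ)]` add like
  angles — `U A + U B ≡ U (A + B)` for `A + B ≤ π` and `U A + U B ≡ U π + U (A + B − π)` beyond — so every finite
  sum of them is a MULTI-TURN CLASS `q • U π + U θ` (`θ ∈ [0, π)`) determined by the total angle alone; a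
  `ℤ`-relation among the angles makes the positive and the negative side the same multi-turn class
  (`angleKernel_stdKernel`). The value relation is used exactly once, as the equality of two real numbers
  (cf. `Cruxes/OffTetraSectorKernel/Disproof.lean`, `false_without_evalZero`); no transcendence input.
* §2 NORMAL FORM: one boundary similarity `x ↦ (x − a)/√c`, `t ↦ t/√c` (rule (2), landed `stub_similarityMove`)
  and one domain-additivity move (rule (1a)) give `[V α β a c] ≡ [Std ((α−a)/√c)] − [Std ((β−a)/√c)]`.
* §3 the registered stub `stub_angleKernel`.

References: M. Kontsevich, D. Zagier, *Periods* (2001), §1.2; J. Ratcliffe, *Foundations of hyperbolic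
manifolds*, §3.5 (area of geodesic polygons); W. D. Neumann, *Hilbert's 3rd problem and invariants of
3-manifolds* (1998), §2 (scissors congruence ladder).
-/

noncomputable section

open Set MeasureTheory Real
open Literature.NumberTheory.Transcendental

namespace Summit.KontsevichZagierPeriods.HyperbolicBloch.OffTetraSectorKernel

/-! ### §0 Small algebra -/

/-- `sin` of an angle in `[0, π]` with algebraic cosine is algebraic (`sin = √(1 − cos²)`). [folklore] -/
theorem angleKernel_isAlgebraic_sin {A : ℝ} (h0 : 0 ≤ A) (hπ : A ≤ π) (hA : IsAlgebraic ℚ (cos A)) :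
    IsAlgebraic ℚ (sin A) := by
  rw [sin_eq_sqrt_one_sub_cos_sq h0 hπ]
  exact rungZero_isAlgebraic_sqrt (isAlgebraic_one.sub (hA.pow 2))

/-- `cos (A + B)` is algebraic when `cos A`, `cos B` are and `A, B ∈ [0, π]`. [folklore] -/
theorem angleKernel_isAlgebraic_cos_add {A B : ℝ} (hA0 : 0 ≤ A) (hAπ : A ≤ π) (hB0 : 0 ≤ B) (hBπ : B ≤ π)
    (hA : IsAlgebraic ℚ (cos A)) (hB : IsAlgebraic ℚ (cos B)) : IsAlgebraic ℚ (cos (A + B)) := by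
  rw [cos_add]
  exact (hA.mul hB).sub ((angleKernel_isAlgebraic_sin hA0 hAπ hA).mul (angleKernel_isAlgebraic_sin hB0 hBπ hB))

/-- `cos (π − A) = −cos A` is algebraic when `cos A` is. [folklore] -/
theorem angleKernel_isAlgebraic_cos_pi_sub {A : ℝ} (hA : IsAlgebraic ℚ (cos A)) :
    IsAlgebraic ℚ (cos (π - A)) := by
  rw [cos_pi_sub]; exact hA.neg

/-- `cos (A − π) = −cos A` is algebraic when `cos A` is. [folklore] -/
theorem angleKernel_isAlgebraic_cos_sub_pi {A : ℝ} (hA : IsAlgebraic ℚ (cos A)) :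
    IsAlgebraic ℚ (cos (A - π)) := by
  rw [cos_sub_pi]; exact hA.neg

/-- The third cosine of the three-triangle relation: for `A, B ∈ [0, π]`,
`√(1 − cos²A) √(1 − cos²B) − cos A cos B = cos (π − (A + B))`. [folklore] -/
theorem angleKernel_third_cos {A B : ℝ} (hA0 : 0 ≤ A) (hAπ : A ≤ π) (hB0 : 0 ≤ B) (hBπ : B ≤ π) :
    Real.sqrt (1 - cos A ^ 2) * Real.sqrt (1 - cos B ^ 2) - cos A * cos B = cos (π - (A + B)) := by
  rw [← sin_eq_sqrt_one_sub_cos_sq hA0 hAπ, ← sin_eq_sqrt_one_sub_cos_sq hB0 hBπ, cos_pi_sub, cos_add]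
  ring

/-- `cos A ∈ (−1, 1)` for `A ∈ (0, π)`. [folklore] -/
theorem angleKernel_cos_mem_Ioo {A : ℝ} (h0 : 0 < A) (hπ : A < π) : -1 < cos A ∧ cos A < 1 := by
  constructor
  · rw [← cos_pi]
    exact cos_lt_cos_of_nonneg_of_le_pi h0.le le_rfl hπ
  · rw [← cos_zero]
    exact cos_lt_cos_of_nonneg_of_le_pi le_rfl hπ.le h0

/-- Uniqueness of the multi-turn decomposition `q π + θ`, `θ ∈ [0, π)`. [folklore] -/
theorem angleKernel_multiTurn_unique {q q' : ℕ} {θ θ' : ℝ} (hθ0 : 0 ≤ θ) (hθ : θ < π) (hθ0' : 0 ≤ θ')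
    (hθ' : θ' < π) (h : (q : ℝ) * π + θ = (q' : ℝ) * π + θ') : q = q' ∧ θ = θ' := by
  have hq : q = q' := by
    by_contra hne
    rcases lt_or_gt_of_ne hne with hlt | hlt
    · have h1 : (q : ℝ) + 1 ≤ q' := by exact_mod_cast hlt
      nlinarith [pi_pos]
    · have h1 : (q' : ℝ) + 1 ≤ q := by exact_mod_cast hlt
      nlinarith [pi_pos]
  subst hq
  exact ⟨rfl, by linarith⟩

/-! ### §1 Angle algebra of the standard classes -/

section AngleAlgebra

/- Throughout this section `S γ` is a fixed family of representations on the standard doubly-ideal triangles,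
`hT` is the three-triangle relation for it and `h1 : [S 1] ∈ relations` (`Std 1 = ∅`). -/
variable {S : ℝ → KZ.IntegralRep 2}
  (hT : ∀ a b : ℝ, IsAlgebraic ℚ a → IsAlgebraic ℚ b → -1 < a → a < 1 → -1 < b → b < 1 → 0 ≤ a + b →
    KZ.of (S a) + KZ.of (S b) + KZ.of (S (Real.sqrt (1 - a ^ 2) * Real.sqrt (1 - b ^ 2) - a * b)) -
      KZ.of (S (-1)) ∈ KZ.relations)
  (h1 : KZ.of (S 1) ∈ KZ.relations)
include hT h1

/-- **Angle addition below `π`.** `[Std cos A] + [Std cos B] ≡ [Std cos (A + B)]` for admissible angles with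
`A + B ≤ π`: two instances of the three-triangle relation (the second one, at `(A + B, π − (A + B))`, has third
class `[Std 1] = [∅]`). [cite: KontsevichZagier2001, §1.2] -/
theorem angleKernel_add_le {A B : ℝ}
    (hA0 : 0 ≤ A) (hB0 : 0 ≤ B) (hAB : A + B ≤ π) (hA : IsAlgebraic ℚ (cos A)) (hB : IsAlgebraic ℚ (cos B)) :
    KZ.of (S (cos A)) + KZ.of (S (cos B)) - KZ.of (S (cos (A + B))) ∈ KZ.relations := by
  rcases hA0.eq_or_lt with rfl | hA0'
  · simpa using h1
  rcases hB0.eq_or_lt with rfl | hB0'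
  · simpa using h1
  have hAπ : A < π := by linarith
  have hBπ : B < π := by linarith
  obtain ⟨ha1, ha2⟩ := angleKernel_cos_mem_Ioo hA0' hAπ
  obtain ⟨hb1, hb2⟩ := angleKernel_cos_mem_Ioo hB0' hBπ
  have hab : 0 ≤ cos A + cos B := by
    have : cos (π - A) ≤ cos B := cos_le_cos_of_nonneg_of_le_pi hB0 (by linarith) (by linarith)
    rw [cos_pi_sub] at this
    linarith
  have h3 := hT (cos A) (cos B) hA hB ha1 ha2 hb1 hb2 hab
  rw [angleKernel_third_cos hA0 hAπ.le hB0 hBπ.le] at h3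
  rcases hAB.eq_or_lt with hEq | hlt
  · -- `A + B = π`: the third class is `[Std 1]`
    rw [hEq, sub_self, cos_zero] at h3
    rw [hEq, cos_pi]
    have : KZ.of (S (cos A)) + KZ.of (S (cos B)) - KZ.of (S (-1)) =
        (KZ.of (S (cos A)) + KZ.of (S (cos B)) + KZ.of (S 1) - KZ.of (S (-1))) - KZ.of (S 1) := by abel
    rw [this]
    exact sub_mem h3 h1
  · -- `A + B < π`: a second instance at `(A + B, π − (A + B))`
    have hS0 : 0 < A + B := by linarith
    obtain ⟨hc1, hc2⟩ := angleKernel_cos_mem_Ioo hS0 hlt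
    obtain ⟨hd1, hd2⟩ := angleKernel_cos_mem_Ioo (by linarith : 0 < π - (A + B)) (by linarith : π - (A + B) < π)
    have hCalg : IsAlgebraic ℚ (cos (A + B)) := angleKernel_isAlgebraic_cos_add hA0 hAπ.le hB0 hBπ.le hA hB
    have hDalg : IsAlgebraic ℚ (cos (π - (A + B))) := angleKernel_isAlgebraic_cos_pi_sub hCalg
    have hsum : 0 ≤ cos (A + B) + cos (π - (A + B)) := by rw [cos_pi_sub]; simp
    have h4 := hT (cos (A + B)) (cos (π - (A + B))) hCalg hDalg hc1 hc2 hd1 hd2 hsum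
    rw [angleKernel_third_cos hS0.le hlt.le (by linarith) (by linarith),
      show π - (A + B + (π - (A + B))) = 0 by ring, cos_zero] at h4
    have : KZ.of (S (cos A)) + KZ.of (S (cos B)) - KZ.of (S (cos (A + B))) =
        (KZ.of (S (cos A)) + KZ.of (S (cos B)) + KZ.of (S (cos (π - (A + B)))) - KZ.of (S (-1))) -
        (KZ.of (S (cos (A + B))) + KZ.of (S (cos (π - (A + B)))) + KZ.of (S 1) - KZ.of (S (-1))) +
        KZ.of (S 1) := by abel
    rw [this]
    exact add_mem (sub_mem h3 h4) h1

/-- **Angle addition beyond `π` (wrap-around).** `[Std cos A] + [Std cos B] ≡ [Std (−1)] + [Std cos (A + B − π)]`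
for admissible `A, B ≤ π` with `π < A + B` (split `B = (π − A) + (A + B − π)` and use `angleKernel_add_le` twice).
[cite: KontsevichZagier2001, §1.2] -/
theorem angleKernel_add_gt {A B : ℝ}
    (hA0 : 0 ≤ A) (hAπ : A ≤ π) (hBπ : B ≤ π) (hAB : π < A + B) (hA : IsAlgebraic ℚ (cos A))
    (hB : IsAlgebraic ℚ (cos B)) :
    KZ.of (S (cos A)) + KZ.of (S (cos B)) - KZ.of (S (cos π)) - KZ.of (S (cos (A + B - π))) ∈ KZ.relations := by
  have hB0 : 0 ≤ B := by linarith [pi_pos]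
  have hpa : IsAlgebraic ℚ (cos (π - A)) := angleKernel_isAlgebraic_cos_pi_sub hA
  have habp : IsAlgebraic ℚ (cos (A + B - π)) :=
    angleKernel_isAlgebraic_cos_sub_pi (angleKernel_isAlgebraic_cos_add hA0 hAπ hB0 hBπ hA hB)
  have e1 := angleKernel_add_le hT h1 (A := π - A) (B := A + B - π) (by linarith) (by linarith) (by linarith) hpa habp
  rw [show π - A + (A + B - π) = B by ring] at e1
  have e2 := angleKernel_add_le hT h1 (A := A) (B := π - A) hA0 (by linarith) (by linarith) hA hpa
  rw [show A + (π - A) = π by ring] at e2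
  have : KZ.of (S (cos A)) + KZ.of (S (cos B)) - KZ.of (S (cos π)) - KZ.of (S (cos (A + B - π))) =
      (KZ.of (S (cos A)) + KZ.of (S (cos (π - A))) - KZ.of (S (cos π))) -
      (KZ.of (S (cos (π - A))) + KZ.of (S (cos (A + B - π))) - KZ.of (S (cos B))) := by abel
  rw [this]
  exact sub_mem e2 e1

/-- **One step of the multi-turn bookkeeping**: adding one admissible angle `A ∈ [0, π]` to a multi-turn class
`q • [Std(−1)] + [Std cos θ]` (`θ ∈ [0, π)`) gives the multi-turn class of `q π + θ + A`. [cite: KontsevichZagier2001, §1.2] -/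
theorem angleKernel_step (q : ℕ) {θ A : ℝ}
    (hθ0 : 0 ≤ θ) (hθ : θ < π) (hθa : IsAlgebraic ℚ (cos θ)) (hA0 : 0 ≤ A) (hAπ : A ≤ π)
    (hA : IsAlgebraic ℚ (cos A)) :
    ∃ (q' : ℕ) (θ' : ℝ), 0 ≤ θ' ∧ θ' < π ∧ IsAlgebraic ℚ (cos θ') ∧ (q' : ℝ) * π + θ' = q * π + θ + A ∧
      (q • KZ.of (S (cos π)) + KZ.of (S (cos θ))) + KZ.of (S (cos A)) -
        (q' • KZ.of (S (cos π)) + KZ.of (S (cos θ'))) ∈ KZ.relations := by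
  rcases lt_trichotomy (θ + A) π with hlt | heq | hgt
  · refine ⟨q, θ + A, by linarith, hlt, angleKernel_isAlgebraic_cos_add hθ0 hθ.le hA0 hAπ hθa hA, by ring, ?_⟩
    have e := angleKernel_add_le hT h1 hθ0 hA0 hlt.le hθa hA
    have : q • KZ.of (S (cos π)) + KZ.of (S (cos θ)) + KZ.of (S (cos A)) -
        (q • KZ.of (S (cos π)) + KZ.of (S (cos (θ + A)))) =
        KZ.of (S (cos θ)) + KZ.of (S (cos A)) - KZ.of (S (cos (θ + A))) := by abel
    rwa [this]
  · refine ⟨q + 1, 0, le_rfl, pi_pos, by rw [cos_zero]; exact isAlgebraic_one, by push_cast; linarith, ?_⟩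
    have e := angleKernel_add_le hT h1 hθ0 hA0 heq.le hθa hA
    rw [heq] at e
    have : q • KZ.of (S (cos π)) + KZ.of (S (cos θ)) + KZ.of (S (cos A)) -
        ((q + 1) • KZ.of (S (cos π)) + KZ.of (S (cos 0))) =
        (KZ.of (S (cos θ)) + KZ.of (S (cos A)) - KZ.of (S (cos π))) - KZ.of (S (cos 0)) := by
      rw [add_smul, one_smul]; abel
    rw [this, cos_zero]
    exact sub_mem e h1
  · refine ⟨q + 1, θ + A - π, by linarith, by linarith, ?_, by push_cast; ring, ?_⟩
    · exact angleKernel_isAlgebraic_cos_sub_pi (angleKernel_isAlgebraic_cos_add hθ0 hθ.le hA0 hAπ hθa hA)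
    · have e := angleKernel_add_gt hT h1 hθ0 hθ.le hAπ hgt hθa hA
      have : q • KZ.of (S (cos π)) + KZ.of (S (cos θ)) + KZ.of (S (cos A)) -
          ((q + 1) • KZ.of (S (cos π)) + KZ.of (S (cos (θ + A - π)))) =
          KZ.of (S (cos θ)) + KZ.of (S (cos A)) - KZ.of (S (cos π)) - KZ.of (S (cos (θ + A - π))) := by
        rw [add_smul, one_smul]; abel
      rwa [this]

/-- **Finite sums of standard classes are multi-turn classes**, determined by the total angle.
[cite: KontsevichZagier2001, §1.2] -/
theorem angleKernel_sum {τ : Type*}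
    (s : Finset τ) (φ : τ → ℝ) (hφ : ∀ i ∈ s, 0 ≤ φ i ∧ φ i ≤ π ∧ IsAlgebraic ℚ (cos (φ i))) :
    ∃ (q : ℕ) (θ : ℝ), 0 ≤ θ ∧ θ < π ∧ IsAlgebraic ℚ (cos θ) ∧ (q : ℝ) * π + θ = ∑ i ∈ s, φ i ∧
      (∑ i ∈ s, KZ.of (S (cos (φ i)))) - (q • KZ.of (S (cos π)) + KZ.of (S (cos θ))) ∈ KZ.relations := by
  classical
  induction s using Finset.induction_on with
  | empty =>
    refine ⟨0, 0, le_rfl, pi_pos, by rw [cos_zero]; exact isAlgebraic_one, by simp, ?_⟩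
    simp only [Finset.sum_empty, zero_smul, zero_add, cos_zero, zero_sub]
    exact neg_mem h1
  | insert i s hi ih =>
    obtain ⟨q, θ, hθ0, hθ, hθa, hsum, hrel⟩ := ih fun j hj => hφ j (Finset.mem_insert_of_mem hj)
    obtain ⟨hi0, hiπ, hia⟩ := hφ i (Finset.mem_insert_self i s)
    obtain ⟨q', θ', hθ0', hθ', hθa', hsum', hrel'⟩ := angleKernel_step hT h1 q hθ0 hθ hθa hi0 hiπ hia
    refine ⟨q', θ', hθ0', hθ', hθa', ?_, ?_⟩
    · rw [Finset.sum_insert hi, hsum', hsum]; ring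
    · rw [Finset.sum_insert hi]
      have : KZ.of (S (cos (φ i))) + ∑ j ∈ s, KZ.of (S (cos (φ j))) -
          (q' • KZ.of (S (cos π)) + KZ.of (S (cos θ'))) =
          (∑ j ∈ s, KZ.of (S (cos (φ j))) - (q • KZ.of (S (cos π)) + KZ.of (S (cos θ)))) +
          (q • KZ.of (S (cos π)) + KZ.of (S (cos θ)) + KZ.of (S (cos (φ i))) -
            (q' • KZ.of (S (cos π)) + KZ.of (S (cos θ')))) := by abel
      rw [this]
      exact add_mem hrel hrel'

omit hT h1 in
/-- Sums with natural multiplicities as plain sums over a sigma type. [folklore] -/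
theorem angleKernel_sum_nsmul_eq_sum_sigma {κ : Type*} [Fintype κ] {M : Type*} [AddCommMonoid M]
    (n : κ → ℕ) (x : κ → M) :
    ∑ m, n m • x m = ∑ p ∈ (Finset.univ : Finset κ).sigma (fun m => Finset.range (n m)), x p.1 := by
  rw [Finset.sum_sigma]
  refine Finset.sum_congr rfl fun m _ => ?_
  dsimp only
  rw [Finset.sum_const, Finset.card_range]

/-- **The angle kernel for standard classes.** If `Σ Cₘ · arccos γₘ = 0` (`γₘ ∈ [−1, 1]` algebraic, `Cₘ ∈ ℤ`),
then `Σ Cₘ • [Std γₘ] ∈ relations`: the positive and the negative side stack up to the SAME multi-turn class.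
The value relation is used here only, as the equality of the two total angles. [cite: KontsevichZagier2001, §1.2] -/
theorem angleKernel_std_kernel_aux {κ : Type*} [Fintype κ] (γ : κ → ℝ) (C : κ → ℤ)
    (hγ : ∀ m, IsAlgebraic ℚ (γ m) ∧ -1 ≤ γ m ∧ γ m ≤ 1) (hker : ∑ m, (C m : ℝ) * arccos (γ m) = 0) :
    ∑ m, C m • KZ.of (S (γ m)) ∈ KZ.relations := by
  classical
  -- angles
  set θ : κ → ℝ := fun m => arccos (γ m) with hθ
  have hcos : ∀ m, cos (θ m) = γ m := fun m => cos_arccos (hγ m).2.1 (hγ m).2.2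
  have hadm : ∀ m, 0 ≤ θ m ∧ θ m ≤ π ∧ IsAlgebraic ℚ (cos (θ m)) := fun m =>
    ⟨arccos_nonneg _, arccos_le_pi _, by rw [hcos]; exact (hγ m).1⟩
  -- positive and negative multiplicities
  set np : κ → ℕ := fun m => (C m).toNat
  set nn : κ → ℕ := fun m => (-C m).toNat
  have hC : ∀ m, C m = (np m : ℤ) - (nn m : ℤ) := fun m => (Int.toNat_sub_toNat_neg (C m)).symm
  -- the two stacks
  obtain ⟨qp, θp, hp0, hpπ, -, hpsum, hprel⟩ := angleKernel_sum hT h1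
    ((Finset.univ : Finset κ).sigma fun m => Finset.range (np m)) (fun p => θ p.1) (fun p _ => hadm p.1)
  obtain ⟨qn, θn, hn0, hnπ, -, hnsum, hnrel⟩ := angleKernel_sum hT h1
    ((Finset.univ : Finset κ).sigma fun m => Finset.range (nn m)) (fun p => θ p.1) (fun p _ => hadm p.1)
  -- equal totals
  have htot : (qp : ℝ) * π + θp = (qn : ℝ) * π + θn := by
    rw [hpsum, hnsum, ← sub_eq_zero, ← angleKernel_sum_nsmul_eq_sum_sigma np θ,
      ← angleKernel_sum_nsmul_eq_sum_sigma nn θ, ← Finset.sum_sub_distrib, ← hker]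
    refine Finset.sum_congr rfl fun m _ => ?_
    rw [nsmul_eq_mul, nsmul_eq_mul, ← sub_mul, hC m]
    push_cast
    rfl
  obtain ⟨hq, hθθ⟩ := angleKernel_multiTurn_unique hp0 hpπ hn0 hnπ htot
  subst hq; subst hθθ
  -- rewrite the integer combination as the difference of the two stacks
  have hsplit : ∑ m, C m • KZ.of (S (γ m)) =
      (∑ p ∈ (Finset.univ : Finset κ).sigma (fun m => Finset.range (np m)), KZ.of (S (cos (θ p.1))) -
        (qp • KZ.of (S (cos π)) + KZ.of (S (cos θp)))) -
      (∑ p ∈ (Finset.univ : Finset κ).sigma (fun m => Finset.range (nn m)), KZ.of (S (cos (θ p.1))) -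
        (qp • KZ.of (S (cos π)) + KZ.of (S (cos θp)))) := by
    rw [sub_sub_sub_cancel_right, ← angleKernel_sum_nsmul_eq_sum_sigma np (fun m => KZ.of (S (cos (θ m)))),
      ← angleKernel_sum_nsmul_eq_sum_sigma nn (fun m => KZ.of (S (cos (θ m)))), ← Finset.sum_sub_distrib]
    refine Finset.sum_congr rfl fun m _ => ?_
    rw [hcos, ← natCast_zsmul, ← natCast_zsmul, ← sub_smul, ← hC m]
  rw [hsplit]
  exact sub_mem hprel hnrel

end AngleAlgebra

/-- **The angle kernel for standard classes** (registered form, all hypotheses explicit): for any family `S γ`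
of representations satisfying the three-triangle relation and `[S 1] ∈ relations`, every `ℤ`-linear relation
`Σ Cₘ · arccos γₘ = 0` among the areas lifts to the relation `Σ Cₘ • [S γₘ] ∈ relations`.
[cite: KontsevichZagier2001, §1.2] -/
theorem angleKernel_stdKernel : ∀ (S : ℝ → Literature.NumberTheory.Transcendental.KZ.IntegralRep 2), (∀ a b : ℝ, IsAlgebraic ℚ a → IsAlgebraic ℚ b → -1 < a → a < 1 → -1 < b → b < 1 → 0 ≤ a + b → Literature.NumberTheory.Transcendental.KZ.of (S a) + Literature.NumberTheory.Transcendental.KZ.of (S b) + Literature.NumberTheory.Transcendental.KZ.of (S (Real.sqrt (1 - a ^ 2) * Real.sqrt (1 - b ^ 2) - a * b)) - Literature.NumberTheory.Transcendental.KZ.of (S (-1)) ∈ Literature.NumberTheory.Transcendental.KZ.relations) → Literature.NumberTheory.Transcendental.KZ.of (S 1) ∈ Literature.NumberTheory.Transcendental.KZ.relations → ∀ (κ : Type) [Fintype κ] (γ : κ → ℝ) (C : κ → ℤ), (∀ m, IsAlgebraic ℚ (γ m) ∧ -1 ≤ γ m ∧ γ m ≤ 1) → ∑ m, (C m : ℝ)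 * Real.arccos (γ m) = 0 → ∑ m, C m • Literature.NumberTheory.Transcendental.KZ.of (S (γ m)) ∈ Literature.NumberTheory.Transcendental.KZ.relations := by
  intro S hT h1 κ _ γ C hγ hker
  exact angleKernel_std_kernel_aux hT h1 γ C hγ hker

end Summit.KontsevichZagierPeriods.HyperbolicBloch.OffTetraSectorKernel

end
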